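import Mathlib
import Summits.MatrixMultiplication.MatrixMultiplication.Theorems.LevelGradedCohnUmansLevelOneGL2DesignsStubTangencySetsHermitianReduction
import Summits.MatrixMultiplication.MatrixMultiplication.Theorems.LevelGradedCohnUmansLevelOneGL2DesignsStubTangencySetsThickening

/-!
# Stub `stub_tangencySets` of the crux `LevelOneGL2Designs` (stmt-MatrixMultiplication-14080) —
wall-breaker axis 5/12, *parabola lifts over finite fields*: the residual `ExposedGraphs ⇒ stub`

`stub_tangencySets_of_exposedGraphs`: if for some `c > 0` and unboundedly many primes `p` there is
an `H`-exposed graph `(X, φ, θ)` over `𝔽_p` (every other graph point at cyclic vertical distance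
`≥ H` from the line of slope `θ x₀` through `(x₀, φ x₀)`) of weight `|X|·H ≥ c·p^{3/2}`, then the
stub holds VERBATIM with constant `c/2`: thicken (`TangencyThickening.tangencySet_of_exposedGraph`)
and move the origin off the tangent lines (`TangencyHermitian.stub_tangencySets_of_affineTangencySets`).
This is the exact residual of the interval-fibre parabola-lift axis; see the seat's AXIS.md for why
no exposed graph of weight `≫ p log p` is known (Burgess/Weil for polynomial `φ`, Dirichlet for
generalized progressions, lattice rigidity only below norm `p` for the Gaussian model).
No new definitions.
-/

-- justification: the tree path `MatrixMultiplication/MatrixMultiplication` (summit = problem) makes every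
-- declaration name contain a duplicated namespace segment, which this linter would flag.
set_option linter.dupNamespace false

open Finset Matrix

namespace Summit.MatrixMultiplication.MatrixMultiplication.Theorems.LevelOneGL2Designs.TangencyThickening

/-- **Reduction of `stub_tangencySets` to exposed graphs** (the residual of this axis, in the stub's
exact quantifier shape).  If for some `c > 0` and unboundedly many primes `p` there is an
`H`-exposed graph `(X, φ, θ)` over `𝔽_p` of weight `|X|·H ≥ c·p^{3/2}`, then the stub holds with
constant `c/2` (`tangencySet_of_exposedGraph`, then the origin-averaging reduction
`TangencyHermitian.stub_tangencySets_of_affineTangencySets`).  The weight of an exposed graph is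
at most `p·H ≤ p²`; parabolas `φ = x²` are exposed only with `H = 1` unless the fibre is replaced
by a Paley coclique (`TangencyPaley.paley_lift_converse`), and generalized-progression graphs are
capped at weight `O(p)` by Dirichlet's approximation theorem — see AXIS.md of this seat; no
exposed graph of weight `≫ p log p` is known. [elementary] -/
theorem stub_tangencySets_of_exposedGraphs
    (h : ∃ c : ℝ, 0 < c ∧ ∀ p₀ : ℕ, ∃ (p : ℕ) (_ : Fact p.Prime), p₀ ≤ p ∧
      ∃ (X : Finset (ZMod p)) (φ θ : ZMod p → ZMod p) (H : ℕ), H ≤ p ∧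
        (∀ x₀ ∈ X, ∀ x ∈ X, x ≠ x₀ →
          H ≤ (φ x - φ x₀ - θ x₀ * (x - x₀)).val ∧
            (φ x - φ x₀ - θ x₀ * (x - x₀)).val + H ≤ p) ∧
        c * (p : ℝ) ^ (3 / 2 : ℝ) ≤ ((X.card * H : ℕ) : ℝ)) :
    ∃ c : ℝ, 0 < c ∧ ∀ p₀ : ℕ, ∃ (p : ℕ) (_ : Fact p.Prime), p₀ ≤ p ∧
      ∃ S : Finset ((Fin 2 → ZMod p) × (Fin 2 → ZMod p)),
        c * (p : ℝ) ^ (3 / 2 : ℝ) ≤ S.card ∧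
        ∀ f ∈ S, ∀ f' ∈ S, (dotProduct f.1 f'.2 = 1 ↔ f = f') := by
  apply FlagLine.TangencyHermitian.stub_tangencySets_of_affineTangencySets
  obtain ⟨c, hc, hfam⟩ := h
  refine ⟨c, hc, fun p₀ => ?_⟩
  obtain ⟨p, hp, hp₀, X, φ, θ, H, hH, hexp, hsize⟩ := hfam p₀
  obtain ⟨V, hV, htan⟩ := @tangencySet_of_exposedGraph p hp X φ θ H hH hexp
  refine ⟨p, hp, hp₀, V, ?_, htan⟩
  rw [hV]
  exact_mod_cast hsize


end Summit.MatrixMultiplication.MatrixMultiplication.Theorems.LevelOneGL2Designs.TangencyThickening
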